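import Literature.Probability.Percolation.SmirnovTheoremProofs
import Summits.CriticalPhenomena.CardyFormulaZ2.Theorems.UnionJackBeffaraUnionJackEndgame
import HarnessLib

/-!
# Smirnov's endgame, abstract in the crossing functional (stub `stub_endgame` of line `Sketch`)

Helper file for the crux `Target` (stmt-CriticalPhenomena-6431) of route `CardyFlipRusso`
(sub-problem `CardyFormulaZ2`), line `Sketch`: the registered stub `stub_endgame`.

Let `R = (Ω; a', b', c', d')` be a conformal rectangle and `p : ℝ → ℝ` any crossing functional
(`p δ` = a crossing probability of `R` at mesh `δ`). Suppose that for every Carleson datum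
`(a, b, c, d, ψ)` of `R` (`abc` non-degenerate equilateral, `d ∈ (c, a)`, `ψ : Ω → Δ` conformal
with boundary values `a, b, c, d` at the marks) there are `δ₀ > 0`, two Smirnov separating families
`g⁻`, `g⁺` (`IsSmirnovFamily`: continuous `[0, 1]`-valued, uniformly equicontinuous, every
subsequential uniform limit satisfies the contour relation (36) and the boundary values (37)),
points `z⁻_δ, z⁺_δ ∈ Ω` tending to `d'` and an error `e(δ) → 0` with
`g⁻_δ¹(z⁻_δ) - e(δ) ≤ p(δ) ≤ g⁺_δ¹(z⁺_δ) + e(δ)` on `(0, δ₀)` — the "Smirnov sandwich" of `p`,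
verbatim the conclusion of the proved triangular fact `smirnov_exists_separatingFamilies` with `p`
for `triDomainCrossingProb R`. Then `R.HasCrossingLimit p cardyFunction`: `p(δ) → F(η(x))` for
every uniformizing datum `(φ, x)` of `R`.

The proof is the tree's passage to the limit (Bollobás–Riordan 2006, Ch. 7, proof of Thm. 2,
pp. 202–203) with the crossing probability abstracted: a Carleson datum exists by the PROVED fact
(B) `exists_isCarlesonMap_holds`; `F(η(x))` is Carleson's ratio `|d - c| / |a - c|` by the PROVED
Cardy–Carleson identity (C) `cardyFunction_crossRatio_eq_carlesonRatio_holds`; and both bounds of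
the sandwich tend to that ratio by the Arzelà–Ascoli argument `IsSmirnovFamily.tendsto_apply_one`
fed with the PROVED facts (M) `triangleIntegral_eq_zero_of_forall_lattice_holds` and (U)
`smirnov_claim24_holds`, packaged in the tree as
`Summit.CriticalPhenomena.CardyFormulaZ2.Theorems.tendsto_carlesonRatio_of_smirnovFamily_sandwich`
(squeeze, `tendsto_of_tendsto_of_tendsto_of_le_of_le'`).

## References

* B. Bollobás, O. Riordan, *Percolation*, Cambridge University Press (2006), Ch. 7, Thm. 2
  (p. 165), proof pp. 202–203; Claim 24 p. 201; eq. (3) p. 163.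
* S. Smirnov, *Critical percolation in the plane: conformal invariance, Cardy's formula, scaling
  limits*, C. R. Acad. Sci. Paris Sér. I 333 (2001) 239–244, Thm. 1.
-/

noncomputable section

namespace Summit.CriticalPhenomena.CardyFormulaZ2.Theorems.CardyFlipRussoTarget

open Filter Set Topology
open scoped Topology
open Literature.Probability.RandomPlanarGeometry
open Literature.Probability.Percolation

/-- **Smirnov's endgame, abstract in the crossing functional** (stub `stub_endgame` of line
`Sketch` for the crux `Target`, stmt-CriticalPhenomena-6431). For a conformal rectangle
`R = (Ω; a', b', c', d')` and any `p : ℝ → ℝ`: if for every Carleson datum `(a, b, c, d, ψ)` of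
`R` two Smirnov separating families `g⁻`, `g⁺` sandwich `p` —
`g⁻_δ¹(z⁻_δ) - e(δ) ≤ p(δ) ≤ g⁺_δ¹(z⁺_δ) + e(δ)` for `0 < δ < δ₀`, with `z^±_δ ∈ Ω`, `z^±_δ → d'`,
`e(δ) → 0` — then `p(δ) → cardyFunction (crossRatio x)` as `δ → 0⁺` for every uniformizing datum
`(φ, x)` of `R`, i.e. `R.HasCrossingLimit p cardyFunction`. Proof: pick a Carleson datum
(`exists_isCarlesonMap_holds`), rewrite `F(η(x))` as Carleson's ratio `|d - c| / |a - c|`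
(`cardyFunction_crossRatio_eq_carlesonRatio_holds`), and squeeze: both bounds tend to that ratio
by `IsSmirnovFamily.tendsto_apply_one` with (M) `triangleIntegral_eq_zero_of_forall_lattice_holds`
and (U) `smirnov_claim24_holds` (`tendsto_carlesonRatio_of_smirnovFamily_sandwich`). Source:
Bollobás–Riordan 2006, Ch. 7, proof of Thm. 2, pp. 202–203 ("`P_δ(G_δ⁻) = f²_δ(z_δ) + o(1) =
h²(φ(P₄)) + o(1)`", the same for `G_δ⁺`, and (3) p. 163); Smirnov 2001, Thm. 1.
[cite: BollobasRiordan2006, Ch. 7 Thm. 2, proof pp. 202–203] [cite: Smirnov2001, Thm. 1] -/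
theorem stub_endgame :
    ∀ (R : ConformalRectangle) (p : ℝ → ℝ),
      (∀ (a b c d : ℂ) (ψ : ConformalEquiv R.carrier (openTriangle a b c)),
        IsEquilateral a b c → d ∈ openSegment ℝ c a → IsCarlesonMap R a b c d ψ →
        ∃ δ₀ > (0 : ℝ), ∃ gm gp : ℝ → Fin 3 → ℂ → ℝ,
          IsSmirnovFamily R a b c δ₀ gm ∧ IsSmirnovFamily R a b c δ₀ gp ∧
          ∃ (zm zp : ℝ → ℂ) (e : ℝ → ℝ),
            (∀ δ ∈ Set.Ioo 0 δ₀, zm δ ∈ R.carrier ∧ zp δ ∈ R.carrier) ∧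
            Tendsto zm (𝓝[>] 0) (𝓝 (R.pt 3)) ∧ Tendsto zp (𝓝[>] 0) (𝓝 (R.pt 3)) ∧
            Tendsto e (𝓝[>] 0) (𝓝 0) ∧
            ∀ δ ∈ Set.Ioo 0 δ₀, gm δ 1 (zm δ) - e δ ≤ p δ ∧ p δ ≤ gp δ 1 (zp δ) + e δ) →
      R.HasCrossingLimit p Literature.Probability.RandomPlanarGeometry.cardyFunction := by
  intro R p hD φ x hφ
  obtain ⟨a, b, c, d, ψ, habc, hd, hψ⟩ := exists_isCarlesonMap_holds R
  rw [cardyFunction_crossRatio_eq_carlesonRatio_holds R a b c d ψ φ x habc hd hψ hφ]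
  obtain ⟨δ₀, hδ₀, gm, gp, hgm, hgp, zm, zp, e, hzmem, hzm, hzp, he, hsand⟩ :=
    hD a b c d ψ habc hd hψ
  exact tendsto_carlesonRatio_of_smirnovFamily_sandwich hδ₀ habc hd hψ hgm hgp hzmem hzm hzp he
    hsand

end Summit.CriticalPhenomena.CardyFormulaZ2.Theorems.CardyFlipRussoTarget

end
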